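import Mathlib
import HarnessLib
import HarnessLib.Audit
import Summits.QuantumFields.Statement
import Literature.MathematicalPhysics.QuantumFieldTheory.YangMillsOS
import HarnessLib.Audit.Status.Attr

/-!
Route: SmallCircleAnchor

DORMANT since 2026-08-26T05:43:13Z (reconciler: no traction for 8.4 d (last activity item-evidence-added at 2026-08-17T19:52:08Z); parked, not closed — `ledger route dormant route-QuantumFields-SmallCircleAnchor --off` to reactivate) — unstaffed, not closed; items shared with open routes are served there. `ledger route dormant <id> --off` reactivates.

# Route SmallCircleAnchor — weak-coupling anchor — the abelianising-pinned small-circle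
(Polyakov/Ünsal–Yaffe) gap made rigorous by Coulomb-gas screening, continued adiabatically in (T,
deformation) to the symmetric Wilson torus

It suffices to show X = ANCHOR ∧ CONTINUITY (card adiabatic-continuity-semiclassical-anchor, spine;
its K1 = AnchorGap, K2 =
AdiabaticContinuity, K3 = EndpointTransfer). ANCHOR (AnchorGap): for every compact simple G and
faithful unitary lattice representation r
there is an ABELIANISING DEFORMATION — a continuous class function V on G minimised exactly on one
conjugacy class Cl(g₀) whose
centraliser is abelian — such that, at every temporal extent T and along some deformation schedule
E(β) above any prescribed
threshold, the pinned Wilson theory on ℤ_T × (ℤ/L)³ with weight exp(β Σ_P Re tr r(U_P) − E(β) Σ_x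
V(P_x)) (P_x the Polyakov line)
clusters exponentially in space with a rate m(β) > 0 UNIFORMLY IN THE SPATIAL VOLUME, for all β ≥
β₀(T): the semiclassical corner
where G → U(1)^r and the affine-coroot monopole-instanton gas is Debye-screened (Polyakov 1977 /
Ünsal–Yaffe 2008 made rigorous by
Göpfert–Mack/Brydges–Federbush technology). CONTINUITY (AdiabaticContinuity): given the anchor, for
all large β one rate m(β) > 0
works along the whole two-leg path — Leg A: every larger temporal extent T′ ≥ T at full deformation;
Leg B: the symmetric torus
ℤ_L × (ℤ/L)³ with the deformation scaled down through s ∈ [0, E(β)] — uniformly in L. The s = 0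
endpoint is the undeformed symmetric
Wilson torus, i.e. (EndpointTransfer, glue) the weak-coupling uniform lattice gap UniformLatticeGap
— the SAME target item as
route ConvexGribovBody (stmt-QuantumFields-8778) — which with the shared imported complement
ContinuumLegGivenGap
(stmt-QuantumFields-15828, the 2026-08-16 re-type of stmt-QuantumFields-8782 for the revised
Statement p116790: a WEAK-COUPLING
scheme β_k → ∞ + continuum limit + OS axioms + continuum gap) gives YangMills.
Lean: `AnchorGap ∧ AdiabaticContinuity`

## Assembly
Pure logic plus one `simp only [zero_mul, sub_zero]` (PROVED sorry-free in the planner's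
Sketch.lean, theorem `assembly_holds`): given a
compact simple G and any faithful r, AnchorGap gives V; AdiabaticContinuity at T = 1 gives ε₁;
AnchorGap
at (T = 1, threshold max ε₁ 0) gives the schedule E and β₀ with the anchor bound;
AdiabaticContinuity returns β₁ and, for each β ≥ β₁,
a rate m with Leg B; Leg B at s = 0 (0 ≤ 0 ≤ E β) is, after `simp`, the hypothesis of
EndpointTransfer, which yields the uniform
lattice gap for r; this holds for every r, so ContinuumLegGivenGap returns the ∃ r sch T … body of
`YangMills` — including its first conjunct
`sch.HasWeakCouplingLimit` (Statement re-type 2026-08-16), which is part of the complement's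
witness, not a separate crux. (`YangMills` is the root-level sub-problem constant of
Summits/QuantumFields/YangMills/Statement.lean — lean/CONVENTIONS.md §2: problem statements are root
names.)

Rationale: WHY THIS LINE. Every existing rigorous result on the lattice gap anchors at STRONG coupling
(Osterwalder–Seiler cluster expansion) and must cross the
crossover in β; this line anchors at WEAK coupling in a corner of the same lattice family that is
simultaneously semiclassical,
non-perturbatively gapped and never strongly coupled — the centre-stabilised small circle of
arXiv:0803.0344 (all simple G via affine
coroots, arXiv:1205.0290, arXiv:1406.1199) — and continues in GEOMETRY (temporal extent, deformation
strength), not in the coupling.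
The rigorous engine imported from constructive statistical mechanics is Debye screening of
three-dimensional lattice Coulomb/monopole
gases (doi:10.1007/bf01961240 Göpfert–Mack 1982, doi:10.1007/bf01942372 Brydges–Federbush 1980,
quantitative U(1) revival
arXiv:2107.04021) on top of Bałaban's small/large-field renormalisation group (Balaban1989) in a
regime where its stopping point (strong
coupling in the infrared) is not met; the deformation is abstracted from the double-trace form to
ANY abelianising class-function
pinning, which answers "for every compact simple G" by Lie theory (regular elements, affine coroots)
and needs no centre. The one-layer
case T = 1 is exactly the lattice Georgi–Glashow/adjoint-Higgs model of Polyakov1977 (Borgs–Seiler's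
one-layer model, BorgsSeiler1983
§III.1), so the rank-2 crux is a classical open problem of independent value; the continuation crux
is Ünsal–Yaffe's "no phase
transition as a function of box size", stated as a path-uniform gap and exposed to lattice
refutation (arXiv:0707.1869). Of the routes opened in parallel today
(GronwallGap continues in β from the strong-coupling anchor; ConvexGribovBody, FluxBootstrap,
OneCertifiedCube, ModularSelfDualFold,
EquipartitionCriticality, CoincidenceRotationBootstrap attack L1 or E1 directly) none uses a
weak-coupling anchor or continuation in
geometry; this route shares their target and complement items verbatim. The negatives index is
empty.

RANKED CRUXES. #0 UniformLatticeGap (target) — (leg L1 — WEAK-COUPLING UNIFORM LATTICE GAP; written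
VERBATIM as route ConvexGribovBody's target stmt-QuantumFields-8778 so the item is shared) for every
compact simple G and every faithful unitary lattice representation r there is β₀ such that for every
β ≥ β₀ there are m > 0 and S₁ with: for all gauge-invariant local observables A, B (YMSpecies) there
is C with |⟨A·τ_{n e₀}B⟩ − ⟨A⟩⟨B⟩| ≤ C e^{−m n} on every symmetric torus of side 2S+1, S ≥ S₁, and
all n ≤ S (`latticeConnectedCorr`, the quantity clustered by `HasLatticeMassGap`). Implied by
AnchorGap → AdiabaticContinuity → EndpointTransfer (proved in the planner's sketch, theorem
target_of_cruxes). (why it might fail: Chatterjee's Problem 5.1 territory: no technique reaches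
large β in d = 4 for non-abelian G; for reducible r, Bhanot–Creutz bulk first-order lines with
critical endpoints sit at intermediate β, so β₁(r) must lie beyond them.) [arXiv:1803.01950,
doi:10.1103/PhysRevD.24.3212, JaffeWitten2000,
Literature.MathematicalPhysics.QuantumFieldTheory.LatticeMassGapAllCouplings]
#2 AnchorGap (crux) — (card K1, THE ANCHOR) for every compact simple G and faithful unitary r there
is an abelianising deformation V (continuous class function on G; minimum set = one conjugacy class
Cl(g₀); C_G(g₀) abelian) such that for every temporal extent T ≥ 1 and every threshold ε₁ there are
a schedule E(β) ≥ ε₁ and β₀ with: for all β ≥ β₀ the deformed theory on ℤ_T × (ℤ/L)³ with weight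
exp(β Σ_P Re tr r.ρ(U_P) − E(β) Σ_x V(P_x(U))) w.r.t. product Haar (vocabulary INLINED over Mathlib,
rev 4 cone repair: sites ℤ_T × (ℤ/L)³, link configurations ((site, time|space direction) → G),
plaquette holonomies, finite-temperature Wilson action with J_E = J_M = β over all plaquettes,
Polyakov line P_x(U) = ordered product of the T time-like links above x, product Haar
`haarProbability`, expectations as ratios of integrals; formerly phrased over the Borgs–Seiler
barrier file's finite-temperature definitions — OLD ↔ NEW machine-checked, evidence Equiv.lean)
clusters exponentially in a spatial direction with some rate m(β) > 0 UNIFORMLY IN L: for every cube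
side w there is C(w) such that for all L, all base points c and all measurable F₁, F₂ bounded by 1
depending only on links based in the spatial cube c + [0,w]³ (all times), |E[F₁ · F₂∘σ_n] − E[F₁]
E[F₂∘σ_n]| ≤ C e^{−m n} whenever 2n < L (σ_n = spatial translation by n). Intended proof: pinning ⇒
G → U(1)^r at scale T (W-bosons of lattice-scale mass ∝ root gaps of g₀), Bałaban small/large-field
integration of non-Cartan and Kaluza–Klein modes ⇒ dilute gas of monopole-instantons labelled by the
affine coroots, fugacity e^{−S₀}, S₀ ∝ β/T; Debye screening (Göpfert–Mack/Brydges–Federbush) ⇒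
dual-photon mass ≍ T⁻¹e^{−S₀/2} ⇒ clustering of everything. [difficulty: open-problem] (why it might
fail: Needs a Bałaban-type derivation of the U(1)^r monopole gas with non-Cartan/KK remainders and
large fields controlled uniformly in the 3-volume, then screening with long-range many-body
corrections; GM82 is Villain-U(1) only — even Wilson-action U(1)₃ screening at weak coupling is
unproved.) [arXiv:0803.0344, doi:10.1007/bf01961240, doi:10.1007/bf01942372, Polyakov1977,
Balaban1989, doi:10.1016/0003-4916(84)90121-0, arXiv:2107.04021]
#3 AdiabaticContinuity (crux) — (card K2, ADIABATIC CONTINUITY, WITH THE PATH) for every G, r, every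
abelianising V and every anchor extent T there is ε₁ such that for every schedule E ≥ ε₁ and every
β₀: IF the anchor (T, E(β)·V) clusters uniformly in L for all β ≥ β₀ (verbatim the conclusion of
AnchorGap, same inline vocabulary), THEN there is β₁ such that for every β ≥ β₁ ONE rate m(β) > 0
clusters, uniformly in L, the whole two-leg family — Leg A (temporal decompactification at full
deformation): the (T′, E(β)V)-theory on ℤ_{T′} × (ℤ/L)³ for EVERY T′ ≥ T; Leg B (switching the
deformation off on the symmetric torus): the (L, sV)-theory on ℤ_L × (ℤ/L)³ for every s ∈ [0, E(β)].
This is Ünsal–Yaffe's 'no phase transition as a function of box size' made quantitative (inf over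
the path of the gap > 0); it is strictly STRONGER than UniformLatticeGap (its s = 0 endpoint) and
independently falsifiable by lattice data on deformed Yang–Mills. (rev 4 signature: anchor
hypothesis verbatim AnchorGap's conclusion; Leg A / Leg B through one local clustering predicate `Cl
τ s β m` — Leg A = `Cl (fun _ => T′) (E β) β m`, Leg B = `Cl (fun L => L) s β m`.) [deps: AnchorGap]
[difficulty: open-problem] (why it might fail: The continuation wall: a bulk first-order transition
at some (T′,β) or (s,β) kills volume-uniform clustering there. Myers–Ogilvie see first-order
deconfined/skewed/confined lines in Polyakov-loop-deformed SU(3), SU(4); continuity has lattice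
support only for SU(2), SU(3) at large deformation.) [arXiv:0803.0344, arXiv:0707.1869,
arXiv:1205.0290, arXiv:1406.1199, doi:10.1007/jhep11(2018)092, arXiv:2405.13696, BorgsSeiler1983]
#4 ContinuumLegGivenGap (crux) — (IMPORTED COMPLEMENT, lowest rank — legs L2/L3 of the Clay problem,
not attacked by this route; RE-TYPED 2026-08-16 for the revised Statement p116790 and written
VERBATIM as the shared item stmt-QuantumFields-15828 (routes HyperbolicRegulator, ConvexGribovBody;
formerly stmt-QuantumFields-8782) so the item stays shared by every lattice-gap-first route) for
every compact simple G: if EVERY faithful unitary r has the weak-coupling uniform lattice gap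
(UniformLatticeGap's body, Borel σ-algebra), then some r carries a sequential scheme sch AT WEAK
COUPLING (sch.HasWeakCouplingLimit: β_k = 2/g₀² → ∞) and OS data T with IsYangMillsFor r sch T,
non-trivial and non-Gaussian curvature field, and Δ > 0 with T.HasMassGap Δ ∧ HasLatticeMassGap r
sch Δ (natural choice β_k → ∞, a_k ≔ m(β_k)/Δ: the hypothesis speaks of ALL β ≥ β₀(r), so weak
coupling is where the construction lives, not an extra assumption — a witness with β_k bounded would
have only ultralocal scaling limits, FixedCouplingUltralocality) — exactly the ∃-body of the revised
`YangMills`. [difficulty: open-problem] (why it might fail: Contains the joint continuum limit of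
all gauge-invariant fields with O(4) invariance (E1) and non-Gaussianity of tr F², both open; pinned
to β_k → ∞ it also needs ξ(β) = 1/m(β) → ∞ as β → ∞ and 1/m(β_k) to be THE correlation length of
every species, with constants uniform in k.) [JaffeWitten2000, Balaban1989, arXiv:1803.01950,
OsterwalderSeiler1978, arXiv:2401.10507, Literature.Barriers.QuantumFields.UVStabilityNonUniqueness,
Literature.Barriers.QuantumFields.FixedCouplingUltralocality]
#9 EndpointTransfer (support) — (GLUE, provable now) the s = 0 endpoint of Leg B, in the
finite-temperature presentation, implies UniformLatticeGap for r: if for all β ≥ β₁ the undeformed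
Wilson theory on ℤ_L × (ℤ/L)³ (weight exp(β Σ_P Re tr r.ρ(U_P)) over all plaquettes, product Haar;
inline vocabulary as in AnchorGap without the deformation term) clusters in a spatial direction with
rate m(β) uniformly in L for bounded local observables, then latticeConnectedCorr r.ρ β (2S+1) A.F
B.F n decays at rate m(β) for all YMSpecies A, B, all S ≥ S₁ and all n ≤ S (S₁ = 0 works). Proof:
identify the configurations (ℤ_L × (ℤ/L)³) × Option (Fin 3) → G with GaugeConfig 4 L G (time =
coordinate 0, `none` = time direction); exp(β Σ_P Re tr) = const·exp(−β·wilsonAction), so the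
normalised measure is wilsonMeasure r.ρ β; coordinate-permutation invariance of the symmetric torus
turns spatial into temporal clustering; a cylinder observable (finite supp) composed with torusLift
(2S+1) depends on links in a cube of side w_A at some base point c; rescale by the bounds of A and
B; n ≤ S ⇔ 2n < 2S+1. [difficulty: provable-now] [OsterwalderSeiler1978, Seiler1982, Wilson1974]
#9 OneLayerAnchor (support) — (SPECIAL CASE T = 1 of AnchorGap = Polyakov 1977 on the lattice;
implied by AnchorGap by instantiation; inline vocabulary as in AnchorGap) with one time layer the
Polyakov line is the single time-like link u_x and the electric plaquettes are β Re tr r(u_x v_{x,i}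
u_{x+i}⁻¹ v_{x,i}⁻¹): Borgs–Seiler's one-layer model, i.e. three-dimensional lattice G-gauge theory
with a G-valued adjoint Higgs, which E(β)V(u_x) pins to the regular class Cl(g₀) — the lattice
Georgi–Glashow model in its abelianising (London) regime. Claim: uniform-in-volume exponential
clustering for all β ≥ β₀. The cleanest sub-target ('make Polyakov's monopole confinement of the 3D
Georgi–Glashow model rigorous') and the first milestone for AnchorGap. [difficulty: XL]
[Polyakov1977, BorgsSeiler1983, doi:10.1007/bf01961240, arXiv:0803.0344]
#9 PolyakovAnchorClustering (support) — (SPECIAL CASE of AnchorGap for the Polyakov-loop two-point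
function — the observable of the Borgs–Seiler barrier; refutation surface; inline vocabulary as in
AnchorGap) same setting and quantifier prefix as AnchorGap, conclusion only for the Polyakov-loop
two-point function: the CONNECTED correlation Re⟨χ(P_0)χ̄(P_{n e₁})⟩ − ⟨Re χ(P_0)⟩⟨Re χ(P_n)⟩ − ⟨Im
χ(P_0)⟩⟨Im χ(P_n)⟩ (χ(P_x) = tr r.ρ of the ordered product of the T time-like links above x) is ≤ C
e^{−m n} uniformly in L. Contrast: WITHOUT deformation
`Literature.Barriers.QuantumFields.FiniteTemperatureDeconfinement` (Borgs–Seiler Thm III.7) gives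
Polyakov long-range order at every T for β ≥ β₀(T) (U(N), SU(N)); the pinning defeats their proof
exactly at the sum rule ⟨|tr u|²⟩ ≥ 1 (III.18), not at the infrared bound, and under
non-centre-symmetric pinning ⟨tr P⟩ ≠ 0 is expected but is not long-range order of the connected
function — a refuter who restores a sum rule forcing a δ(p)-mass in the CONNECTED spectral measure
kills AnchorGap. [difficulty: XL] [BorgsSeiler1983, arXiv:0803.0344,
Literature.Barriers.QuantumFields.FiniteTemperatureDeconfinement]

TWO-LAYER PLAN. Foreseen glued splits (nothing filed now; k ≤ 3, depth 1): AnchorGap ⇐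
AbelianisationWithRemainders → CoulombGasScreening → AnchorGap
— (i) Bałaban small/large-field integration of the non-Cartan and Kaluza–Klein modes of the pinned
theory giving a U(1)^r /
integer-monopole-current representation with summable multi-body remainders, uniformly in L; (ii)
Debye screening for that perturbed
three-dimensional Coulomb gas (Göpfert–Mack/Brydges–Federbush extended to small complex-analytic
perturbations), for every simple G
through its affine coroots; needs the definition requests below. AdiabaticContinuity ⇐
LegAContinuity → LegBRemoval →
AdiabaticContinuity (the two legs), with the Gronwall/Feynman–Hellmann differential inequality of
card gronwall-gap-continuation-sum-rule
as a candidate vehicle for Leg A (discrete in T′: gap stability under adding one time layer).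
ContinuumLegGivenGap is not split here
(shared; other routes own legs L2/L3). OneLayerAnchor is the recommended first direct attack on
AnchorGap.

KILL CRITERIA. ¬AnchorGap for some simple G (a massless phase or non-uniform clustering of the
pinned one-layer model at arbitrarily large β in d = 3)
closes the route `refuted:AnchorGap` — it would refute Polyakov's mechanism itself.
¬AdiabaticContinuity by a rigorous (or
numerically unambiguous, then filed as evidence) first-order transition on Leg A at LARGE
deformation for some abelianising V ⇒ pivot by
`--restate`: restrict V to centre-symmetric pinning (tr r(g₀ⁿ) = 0) or to the 't Hooft-flux variant
(arXiv:2201.06166), or move the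
continuation into anisotropy at T = 1; a transition on Leg B (symmetric torus, deformation removal)
closes the route. ¬UniformLatticeGap (a
Coulomb phase at arbitrarily large β for some simple G and faithful r) kills every lattice-gap-first
route including this one.
UniformLatticeGap proved by another route ⇒ `superseded` for the summit (AnchorGap keeps independent
value as the rigorous Polyakov mechanism).

NOT DECOMPOSED YET. Deliberately left for layer 2: the constants (monopole action S₀ ≍ 4π²β/N² for
SU(N), Debye mass), the large-field apparatus and the
Kaluza–Klein bounds, the precise Coulomb-gas/sine-Gordon measure (a definition request once
AnchorGap is staffed), the group-by-group
check that monopole weights are real and positive under regular pinning (θ = 0), the Leg A / Leg B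
split of AdiabaticContinuity,
reflection-positivity/transfer-matrix restatements of "uniform clustering" as spectral gaps (spatial
RP survives the deformation,
temporal RP does not), and the β-uniformity of clustering constants needed by `HasLatticeMassGap`
along β_k → ∞ (left inside
ContinuumLegGivenGap, where the spectral theory lives anyway).

CHEAPEST FALSIFIER. A lookup, no computation: is there a measured first-order transition in the
temporal extent N_t at FIXED LARGE trace deformation in
deformed SU(3)/SU(4) lattice studies (arXiv:0707.1869; Bonati–Cardinali–D'Elia–Mazziotti,
θ-dependence of trace-deformed SU(3),
2018–20; Athenodorou–Cardinali–D'Elia, spectrum of trace-deformed YM, 2020)? One such point on Leg A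
kills AdiabaticContinuity as
stated. Pen and paper: AdiabaticContinuity quantifies over ALL abelianising V, including pinning at
a NON-centre-symmetric regular
class; check in SU(3) whether explicit centre breaking of that strength ends the first-order
deconfinement line in a critical endpoint
+ crossover (expected) or leaves a first-order remnant at some T′ — the latter forces the
centre-symmetric restatement. For AnchorGap:
confirm that Borgs–Seiler's infrared bound (it survives single-site pinning) plus any sum rule valid
under pinning does NOT force a
δ(p)-mass in the CONNECTED Polyakov spectral measure at T = 1. No kit job run (compute-free hub);
the card's G₂ one-loop check is moot
since V abelianises by hypothesis.

NUMBERS. SU(N), fundamental Wilson action β = 2N/g²: monopole-instanton action S₀ = 8π²/(g²N) =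
4π²β/N², W-mass ≍ 2π/(N T) (lattice units,
centre-symmetric pinning), dual-photon (Debye) mass m_γ ≍ T⁻¹ e^{−S₀/2} — the expected anchor rate
m(β) (arXiv:0803.0344 §3–4).
Borgs–Seiler: undeformed deconfinement at one layer for J_E ≥ N·I(3), I(3) = 0.5054 (BorgsSeiler1983
Cor. III.5); Myers–Ogilvie:
SU(3) with adjoint Polyakov term H_A on 24³×4: deconfined → skewed (Z₃-breaking) → confined as H_A
decreases through ≈ −0.05…−0.1, both
transitions first order (arXiv:0707.1869 §3). Items at open: 8 (shared target, 3 cruxes incl. the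
shared complement, 3 support, assembly); rev 4 restates 5 of them 1:1 (same decl names); rev 5
(2026-08-16, statement re-type p116790) restates the complement 1:1 onto stmt-QuantumFields-15828 —
`closes` and `Assembly` unchanged textually.

DEFINITION REQUESTS. None (rev 4, cone repair 2026-08-15): the finite-temperature vocabulary — sites
ℤ_T × (ℤ/L)³, link configurations,
plaquette holonomies, Wilson action with J_E = J_M = β over all plaquettes, Polyakov line as the
ordered product of the T time-like links,
product Haar `haarProbability`, expectations as ratios of integrals — is INLINED over Mathlib in
every statement, so the route file needs no
import beyond the summit Statement (revs 0–3 phrased it over the Borgs–Seiler barrier file's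
`FiniteTemperature.*` definitions, which dragged
that file's unproved XL fact into the route's import cone although no item uses it as a hypothesis);
OLD ↔ NEW equivalence of the five
restated items (AnchorGap, AdiabaticContinuity, OneLayerAnchor, PolyakovAnchorClustering,
EndpointTransfer) is machine-checked (evidence
Equiv.lean on the route item and on the rev-3 AnchorGap item stmt-QuantumFields-9036); wilsonMeasure
/ latticeConnectedCorr, YMSpecies, OSData as before. Foreseen with the AnchorGap split:
`CoulombGasMeasure` (sine-Gordon / integer-current Coulomb
gas on (ℤ/L)³ with Gaussian covariance (−Δ)⁻¹ and fugacity z; topic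
Literature/MathematicalPhysics/StatisticalMechanics) and
`DeformedThermalExpectation` (Summits/QuantumFields/YangMills/Theorems; abbreviates the inline
let-chain St/Cfg/ν/sh/pl/act/P/wgt/Ex
shared by all five finite-temperature items). Cite facts wanted as
hypotheses for the split: Göpfert–Mack 1982, doi:10.1007/bf01961240 (Villain U(1)₃: string tension
and mass gap for all β; paywalled
here, acq-00548) and Brydges–Federbush 1980, doi:10.1007/bf01942372 (Debye screening).

Novelty: Searches (2026-08-15): `lit frontier QuantumFields --since 2020` (30 rows; nearest rigorous
neighbours arXiv:2401.10507 SU(2) YMH scaling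
limit, arXiv:2605.16162 SO(3) strong-coupling deconfinement — none on small-circle/deformed
anchors); `lit bridges QuantumFields --cross
any` (30 rows, all percolation/Ising side); `lit search --source arxiv "center-stabilized Yang-Mills
confinement large N volume
independence"` (2: arXiv:0803.0344, arXiv:0808.2485); `--source arxiv "Myers Ogilvie new phases
SU(3) SU(4) …"` (2: arXiv:0707.1869,
arXiv:0710.0674); `--source arxiv "Continuity deconfinement super Yang-Mills theory"` (6:
arXiv:1205.0290, arXiv:1406.1199,
arXiv:1310.3522, arXiv:1302.2641, …); `--source arxiv "theta dependence trace deformed Yang-Mills"`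
(1: arXiv:2405.13696); `--source
crossref "Proof of confinement of static quarks in 3-dimensional U(1) …"` (doi:10.1007/bf01961240,
196 citations); `--source zbmath
"Georgi-Glashow lattice confinement monopole"` (2, physics only: hep-th/0403095, hep-th/0410167);
`--source crossref "Debye screening
dilute monopole gas non-abelian Higgs model lattice proof confinement three dimensions"` (8, none
rigorous); `--source crossref "The mass
gap for Higgs models on a unit lattice"` (doi:10.1016/0003-4916(84)90121-0;
doi:10.1007/s00023-019-00840-0 — abelian Higgs with COMPLETE
breaking, no residual U(1)); `--source arxiv "Improved spin-wave estimate …"` (arXiv:2107.04021);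
`lit galaxy search "center-stabilized
Yang-Mills" --star all` (0); `  [refs: 10.1007/bf01961240, 10.1016/0003-4916(84, 10.1007/s00023-019-00840-0, 10.1007/bf01942372, 2401.10507, 2605.16162, 0803.0344, 0808.2485, 0707.1869, 0710.0674, 1205.0290, 1406.1199, 1310.3522, 1302.2641, 2405.13696, 2107.04021, doi:10.1007/bf01961240, doi:10.1016/0003-4916, doi:10.1007/s00023-019-00840-0, doi:10.1007/bf01942372, Polyakov1977, BorgsSeiler1983]

Barriers (technique_class: adiabatic-continuity-anchor, coulomb-gas-screening): - technique_class: adiabatic-continuity-anchor, coulomb-gas-screening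
- Literature.Barriers.QuantumFields.FiniteTemperatureDeconfinement: evaded by construction and the
reason for the deformation — Borgs–Seiler's long-range order at fixed T and large β is for the
UNDEFORMED Wilson action; the pinning E(β)V(P_x) breaks their sum rule ⟨|tr u|²⟩ ≥ 1 (III.18) while
the infrared bound survives harmlessly; AnchorGap/PolyakovAnchorClustering assert clustering of
CONNECTED correlations, compatible with ⟨tr P⟩ ≠ 0 under non-symmetric pinning.
- Literature.Barriers.QuantumFields.DiluteInstantonGasDivergence: evaded — the saddles are
monopole-instantons of fixed size ≍ T in a theory abelianised at scale T; there is no size modulus,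
and the diluteness parameter e^{−S₀}, S₀ ∝ β/T, is honestly small at the anchor.
- Literature.Barriers.QuantumFields.AbelianDeconfinementD4: the schema is group-SENSITIVE — it needs
non-abelian cores (π₂(G/T^r) ≠ 0) and the effective dimension 3, where even U(1) confines
(Göpfert–Mack); V, g₀ and the affine coroots of G enter the statements; nothing is claimed for
U(1)₄, whose massless phase (AbelianMasslessPhaseD4) is consistent with all items.
- Literature.Barriers.QuantumFields.EguchiKawaiBreakdown: finite N and finite spatial volume → ∞
throughout; the deformation is the published cure of Eguchi–Kawai centre breaking, but no volume
reduction is used.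
- Literature.Barriers.QuantumFields.PerturbativeInvisibility: the anchor gap ≍ T⁻¹e^{−S₀/2} is
non-perturb

History (route lifecycle, newest last):
- 2026-08-15T14:00:44Z · rev 1: dropped Target, ContinuumComplement, EndpointTransfer — complete the DRAFT shell of the 13:47Z open (gate response lost), step 1/3: replace Target→UniformLatticeGap and ContinuumComplement→ContinuumLegGivenGap (verba (planner-plancard-QuantumFields-YangMills-adia-c96dbbf4-0)
- 2026-08-15T14:08:37Z · rev 2: restated Assembly (stmt-QuantumFields-9042) — step 2/3: restate Assembly over the renamed complement ContinuumLegGivenGap and supply the deciding theorem closes (sorry-free; elaborates under the gate opens (planner-plancard-QuantumFields-YangMills-adia-c96dbbf4-0)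
- 2026-08-15T16:49:42Z · rev 4: restated AnchorGap (stmt-QuantumFields-9036), AdiabaticContinuity (stmt-QuantumFields-9037), OneLayerAnchor (stmt-QuantumFields-9040), PolyakovAnchorClustering (stmt-QuantumFields-9041), EndpointTransfer (stmt-QuantumFields-9543) — cone repair (unit rrepair-QuantumFields-SmallCircleAncho-37071b1c-g2): restate An (planner-rrepair-QuantumFields-SmallCircleAncho-37071b1c-g2-0)
- 2026-08-16T17:42:01Z · rev 5: restated ContinuumLegGivenGap (stmt-QuantumFields-8782) — route-repair (statement-revised p116790, unit rrepair-QuantumFields-SmallCircleAncho-29b41918): `YangMills` gained the first conjunct `sch.HasWeakCouplingLimit` (planner-rrepair-QuantumFields-SmallCircleAncho-29b41918-0)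
- 2026-08-26T05:43:13Z · DORMANT — reconciler: no traction for 8.4 d (last activity item-evidence-added at 2026-08-17T19:52:08Z); parked, not closed — `ledger route dormant route-QuantumFields-Sm (operator:999:800341)

sub-problem: YangMills · status: dormant · opened planner-plancard-QuantumFields-YangMills-adia-c96dbbf4-0 2026-08-15T13:47:37Z · rev 5 · ledger route-QuantumFields-SmallCircleAnchor
GENERATED by the gate from the ledger (D-0016/17). Provers cite these decls: `theorem foo : Summit.QuantumFields.YangMills.Theses.SmallCircleAnchor.<Decl> := …` in Summits/QuantumFields/YangMills/Theorems/<Name>.lean.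
-/

namespace Summit.QuantumFields.YangMills.Theses.SmallCircleAnchor

open scoped BigOperators Topology Manifold Classical MeasureTheory ProbabilityTheory Matrix InnerProductSpace ComplexConjugate ContinuousMap
open Filter Set Function TopologicalSpace MeasureTheory

attribute [summit_statement] _root_.YangMills

/-- item stmt-QuantumFields-8778 · target · rank 0 · open · by planner
why it might fail: Chatterjee's Problem 5.1 territory: no technique reaches large β in d = 4 for non-abelian G; for reducible r, Bhanot–Creutz bulk first-order lines with critical endpoints sit at intermediate β, so β₁(r) must lie beyond them.
sources: arXiv:1803.01950, doi:10.1103/PhysRevD.24.3212, JaffeWitten2000, Literature.MathematicalPhysics.QuantumFieldTheory.LatticeMassGapAllCouplings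
[target] for every compact simple Lie group G and faithful unitary lattice representation r there is
β₀ with: for all β ≥ β₀ there are m > 0 and S₁ such that for all gauge-invariant local observables
A, B there is C with |⟨A·τ_n B⟩ − ⟨A⟩⟨B⟩| ≤ C e^{−m n} on every torus (2S+1)⁴, S ≥ S₁, n ≤ S, under
Wilson's measure at coupling β (volume-uniform weak-coupling lattice mass gap; the
`latticeConnectedCorr` shape of `HasLatticeMassGap` at fixed β). -/
@[route_item "route-QuantumFields-SmallCircleAnchor"]
def UniformLatticeGap : Prop :=
  ∀ (G : Type) [Group G] [TopologicalSpace G] [IsTopologicalGroup G] [CompactSpace G] [MeasurableSpace G] [BorelSpace G], Literature.MathematicalPhysics.QuantumFieldTheory.IsCompactSimpleLieGroup G → ∀ r : Literature.MathematicalPhysics.QuantumFieldTheory.LatticeRep G, ∃ β₀ : ℝ, ∀ β : ℝ, β₀ ≤ β → ∃ m : ℝ, 0 < m ∧ ∃ S₁ : ℕ, ∀ A B : Literature.MathematicalPhysics.QuantumFieldTheory.YMSpecies G, ∃ C : ℝ, ∀ S n : ℕ, S₁ ≤ S → n ≤ S → |Literature.MathematicalPhysics.QuantumFieldTheory.latticeConnectedCorr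 r.ρ β (2 * S + 1) A.F B.F n| ≤ C * Real.exp (-(m * n))

-- earlier AnchorGap (stmt-QuantumFields-9036, replaced 2026-08-15T16:49:42Z -> stmt-QuantumFields-11141): retired by None — ∀ (G : Type) [Group G] [TopologicalSpace G] [IsTopologicalGroup G] [CompactSpace G], Literature.MathematicalPhysics.QuantumFieldTheory.IsCompactSimpleLieGroup G → letI : MeasurableSpace G := borel G; haveI : BorelSpace G := ⟨rfl⟩; ∀ r : Literature.MathematicalPhysics.QuantumFie
/-- item stmt-QuantumFields-11141 · crux · rank 2 · open · by planner
why it might fail: Needs a Bałaban-type derivation of the U(1)^r monopole gas with non-Cartan/KK remainders and large fields controlled uniformly in the 3-volume, then screening with long-range many-body corrections; GM82 is Villain-U(1) only — even Wilson-action U(1)₃ screening at weak coupling is unproved.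
sources: arXiv:0803.0344, doi:10.1007/bf01961240, doi:10.1007/bf01942372, Polyakov1977, Balaban1989, doi:10.1016/0003-4916(84)90121-0
[crux] (card K1, THE ANCHOR) for every compact simple G and faithful unitary r there is an
abelianising deformation V (continuous class function on G; minimum set = one conjugacy class
Cl(g₀); C_G(g₀) abelian) such that for every temporal extent T ≥ 1 and every threshold ε₁ there are
a schedule E(β) ≥ ε₁ and β₀ with: for all β ≥ β₀ the deformed theory on ℤ_T × (ℤ/L)³ with weight
exp(β Σ_P Re tr r.ρ(U_P) − E(β) Σ_x V(P_x(U))) w.r.t. product Haar (vocabulary INLINED over Mathlib,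
rev 4 cone repair: sites ℤ_T × (ℤ/L)³, link configurations ((site, time|space direction) → G),
plaquette holonomies, finite-temperature Wilson action with J_E = J_M = β over all plaquettes,
Polyakov line P_x(U) = ordered product of the T time-like links above x, product Haar
`haarProbability`, expectations as ratios of integrals; formerly phrased over the Borgs–Seiler
barrier file's finite-temperature definitions — OLD ↔ NEW machine-checked, evidence Equiv.lean)
clusters exponentially in a spatial direction with some rate m(β) > 0 UNIFORMLY IN L: for every cube
side w there is C(w) such that for all L, all base points c and all measurable F₁, F₂ bounded by 1
depending only on links based in the spatial cube -/
@[route_item "route-QuantumFields-SmallCircleAnchor", crux]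
def AnchorGap : Prop :=
  ∀ (G : Type) [Group G] [TopologicalSpace G] [IsTopologicalGroup G] [CompactSpace G], Literature.MathematicalPhysics.QuantumFieldTheory.IsCompactSimpleLieGroup G → letI : MeasurableSpace G := borel G; haveI : BorelSpace G := ⟨rfl⟩; ∀ r : Literature.MathematicalPhysics.QuantumFieldTheory.LatticeRep G, ∃ V : G → ℝ, (Continuous V ∧ (∀ a g : G, V (a * g * a⁻¹) = V g) ∧ ∃ g₀ : G, (∀ g : G, V g₀ ≤ V g) ∧ (∀ g : G, V g = V g₀ → ∃ a : G, g = a * g₀ * a⁻¹) ∧ (∀ a b : G, a * g₀ = g₀ * a → b * g₀ = g₀ * b → a * b = b * a)) ∧ ∀ (T : ℕ) [NeZero T], ∀ ε₁ : ℝ, ∃ E : ℝ → ℝ, (∀ β : ℝ, ε₁ ≤ E β) ∧ ∃ β₀ : ℝ, ∀ β : ℝ, β₀ ≤ β → ∃ m : ℝ, 0 < m ∧ ∀ w : ℕ, ∃ C : ℝ, ∀ (L : ℕ) [NeZero L], let St := ZMod T × (Fin 3 → ZMod L); let Cfg := St × Option (Fin 3) → G; let ν : MeasureTheory.Measure Cfg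 := MeasureTheory.Measure.pi fun _ => Literature.MathematicalPhysics.QuantumFieldTheory.haarProbability G; let sh : St → Option (Fin 3) → St := fun x μ => Option.elim μ (x.1 + 1, x.2) fun i => (x.1, x.2 + Pi.single i 1); let pl : Cfg → St → Option (Fin 3) → Option (Fin 3) → G := fun U x μ κ => U (x, μ) * U (sh x μ, κ) * (U (sh x κ, μ))⁻¹ * (U (x, κ))⁻¹; let act : Cfg → ℝ := fun U => β * ∑ x : St, ∑ i : Fin 3, (r.ρ (pl U x none (some i))).trace.re + β * ∑ x : St, ∑ q : {q : Fin 3 × Fin 3 // q.1 < q.2}, (r.ρ (pl U x (some q.1.1) (some q.1.2))).trace.re; let P : Cfg → (Fin 3 → ZMod L) → G := fun U x => (List.ofFn fun t : Fin T => U ((((t : ℕ) : ZMod T), x), none)).prod; let wgt : Cfg → ℝ := fun U => Real.exp (act U - E β * ∑ x : Fin 3 → ZMod L, V (P U x)); let Ex : (Cfg → ℝ) → ℝ := fun F => (∫ U, F U * wgt U ∂ν) / (∫ U, wgt U ∂ν); let σ : ℕ → Cfg → Cfg := fun n U p => U ((p.1.1, p.1.2 + Pi.single 0 (n : ZMod L)),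 p.2); ∀ (c : Fin 3 → ZMod L), let Loc := fun F : Cfg → ℝ => Measurable F ∧ (∀ U, |F U| ≤ 1) ∧ ∀ U U', (∀ p, (∀ i : Fin 3, (p.1.2 i - c i).val ≤ w) → U p = U' p) → F U = F U'; ∀ F₁ F₂ : Cfg → ℝ, Loc F₁ → Loc F₂ → ∀ n : ℕ, 2 * n < L → |Ex (fun U => F₁ U * F₂ (σ n U)) - Ex F₁ * Ex (fun U => F₂ (σ n U))| ≤ C * Real.exp (-(m * n))

-- earlier AdiabaticContinuity (stmt-QuantumFields-9037, replaced 2026-08-15T16:49:42Z -> stmt-QuantumFields-11142): retired by None — ∀ (G : Type) [Group G] [TopologicalSpace G] [IsTopologicalGroup G] [CompactSpace G], Literature.MathematicalPhysics.QuantumFieldTheory.IsCompactSimpleLieGroup G → letI : MeasurableSpace G := borel G; haveI : BorelSpace G := ⟨rfl⟩; ∀ (r : Literature.MathematicalPhysics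
/-- item stmt-QuantumFields-11142 · crux · rank 3 · open · by planner
why it might fail: The continuation wall: a bulk first-order transition at some (T′,β) or (s,β) kills volume-uniform clustering there. Myers–Ogilvie see first-order deconfined/skewed/confined lines in Polyakov-loop-deformed SU(3), SU(4); continuity has lattice support only for SU(2), SU(3) at large deformation.
sources: arXiv:0803.0344, arXiv:0707.1869, arXiv:1205.0290, arXiv:1406.1199, doi:10.1007/jhep11(2018)092, arXiv:2405.13696
[crux] (card K2, ADIABATIC CONTINUITY, WITH THE PATH) for every G, r, every abelianising V and every
anchor extent T there is ε₁ such that for every schedule E ≥ ε₁ and every β₀: IF the anchor (T,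
E(β)·V) clusters uniformly in L for all β ≥ β₀ (verbatim the conclusion of AnchorGap, same inline
vocabulary), THEN there is β₁ such that for every β ≥ β₁ ONE rate m(β) > 0 clusters, uniformly in L,
the whole two-leg family — Leg A (temporal decompactification at full deformation): the (T′,
E(β)V)-theory on ℤ_{T′} × (ℤ/L)³ for EVERY T′ ≥ T; Leg B (switching the deformation off on the
symmetric torus): the (L, sV)-theory on ℤ_L × (ℤ/L)³ for every s ∈ [0, E(β)]. This is Ünsal–Yaffe's
'no phase transition as a function of box size' made quantitative (inf over the path of the gap >
0); it is strictly STRONGER than UniformLatticeGap (its s = 0 endpoint, via EndpointTransfer) and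
independently falsifiable by lattice data on deformed Yang–Mills. (rev 4 signature: the anchor
hypothesis is spelled out verbatim as AnchorGap's conclusion; Leg A / Leg B are written through ONE
local clustering predicate `Cl τ s β m` = volume-uniform spatial exponential clustering at rate m of
the (τ(L), s·V)-deformed -/
@[route_item "route-QuantumFields-SmallCircleAnchor", crux]
def AdiabaticContinuity : Prop :=
  ∀ (G : Type) [Group G] [TopologicalSpace G] [IsTopologicalGroup G] [CompactSpace G], Literature.MathematicalPhysics.QuantumFieldTheory.IsCompactSimpleLieGroup G → letI : MeasurableSpace G := borel G; haveI : BorelSpace G := ⟨rfl⟩; ∀ (r : Literature.MathematicalPhysics.QuantumFieldTheory.LatticeRep G) (V : G → ℝ), (Continuous V ∧ (∀ a g : G, V (a * g * a⁻¹) = V g) ∧ ∃ g₀ : G, (∀ g : G, V g₀ ≤ V g) ∧ (∀ g : G, V g = V g₀ → ∃ a : G, g = a * g₀ * a⁻¹) ∧ (∀ a b : G, a * g₀ = g₀ * a → b * g₀ = g₀ * b → a * b = b * a)) → ∀ (T : ℕ) [NeZero T], let Cl := fun (τ : ℕ → ℕ) (s β m : ℝ) => ∀ w : ℕ, ∃ C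 : ℝ, ∀ (L : ℕ) [NeZero L] [NeZero (τ L)], let St := ZMod (τ L) × (Fin 3 → ZMod L); let Cfg := St × Option (Fin 3) → G; let ν : MeasureTheory.Measure Cfg := MeasureTheory.Measure.pi fun _ => Literature.MathematicalPhysics.QuantumFieldTheory.haarProbability G; let sh : St → Option (Fin 3) → St := fun x μ => Option.elim μ (x.1 + 1, x.2) fun i => (x.1, x.2 + Pi.single i 1); let pl : Cfg → St → Option (Fin 3) → Option (Fin 3) → G := fun U x μ κ => U (x, μ) * U (sh x μ, κ) * (U (sh x κ, μ))⁻¹ * (U (x, κ))⁻¹; let act : Cfg → ℝ := fun U => β * ∑ x : St, ∑ i : Fin 3, (r.ρ (pl U x none (some i))).trace.re + β * ∑ x : St, ∑ q : {q : Fin 3 × Fin 3 // q.1 < q.2}, (r.ρ (pl U x (some q.1.1) (some q.1.2))).trace.re; let P : Cfg → (Fin 3 → ZMod L) → G := fun U x => (List.ofFn fun t : Fin (τ L) => U ((((t : ℕ) : ZMod (τ L)), x), none)).prod; let wgt : Cfg → ℝ := fun U => Real.exp (act U - s * ∑ x : Fin 3 → ZMod L, V (P U x)); let Ex : (Cfg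 → ℝ) → ℝ := fun F => (∫ U, F U * wgt U ∂ν) / (∫ U, wgt U ∂ν); let σ : ℕ → Cfg → Cfg := fun n U p => U ((p.1.1, p.1.2 + Pi.single 0 (n : ZMod L)), p.2); ∀ (c : Fin 3 → ZMod L), let Loc := fun F : Cfg → ℝ => Measurable F ∧ (∀ U, |F U| ≤ 1) ∧ ∀ U U', (∀ p, (∀ i : Fin 3, (p.1.2 i - c i).val ≤ w) → U p = U' p) → F U = F U'; ∀ F₁ F₂ : Cfg → ℝ, Loc F₁ → Loc F₂ → ∀ n : ℕ, 2 * n < L → |Ex (fun U => F₁ U * F₂ (σ n U)) - Ex F₁ * Ex (fun U => F₂ (σ n U))| ≤ C * Real.exp (-(m * n)); ∃ ε₁ : ℝ, ∀ E : ℝ → ℝ, (∀ β : ℝ, ε₁ ≤ E β) → ∀ β₀ : ℝ, (∀ β : ℝ, β₀ ≤ β → ∃ m : ℝ, 0 < m ∧ ∀ w : ℕ, ∃ C : ℝ, ∀ (L : ℕ) [NeZero L], let St := ZMod T × (Fin 3 → ZMod L); let Cfg := St × Option (Fin 3) → G; let ν : MeasureTheory.Measure Cfg := MeasureTheory.Measure.pi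 fun _ => Literature.MathematicalPhysics.QuantumFieldTheory.haarProbability G; let sh : St → Option (Fin 3) → St := fun x μ => Option.elim μ (x.1 + 1, x.2) fun i => (x.1, x.2 + Pi.single i 1); let pl : Cfg → St → Option (Fin 3) → Option (Fin 3) → G := fun U x μ κ => U (x, μ) * U (sh x μ, κ) * (U (sh x κ, μ))⁻¹ * (U (x, κ))⁻¹; let act : Cfg → ℝ := fun U => β * ∑ x : St, ∑ i : Fin 3, (r.ρ (pl U x none (some i))).trace.re + β * ∑ x : St, ∑ q : {q : Fin 3 × Fin 3 // q.1 < q.2}, (r.ρ (pl U x (some q.1.1) (some q.1.2))).trace.re; let P : Cfg → (Fin 3 → ZMod L) → G := fun U x => (List.ofFn fun t : Fin T => U ((((t : ℕ) : ZMod T), x), none)).prod; let wgt : Cfg → ℝ := fun U => Real.exp (act U - E β * ∑ x : Fin 3 → ZMod L, V (P U x)); let Ex : (Cfg → ℝ) → ℝ := fun F => (∫ U, F U * wgt U ∂ν) / (∫ U, wgt U ∂ν); let σ : ℕ → Cfg → Cfg := fun n U p => U ((p.1.1, p.1.2 + Pi.single 0 (n : ZMod L)), p.2); ∀ (c : Fin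 3 → ZMod L), let Loc := fun F : Cfg → ℝ => Measurable F ∧ (∀ U, |F U| ≤ 1) ∧ ∀ U U', (∀ p, (∀ i : Fin 3, (p.1.2 i - c i).val ≤ w) → U p = U' p) → F U = F U'; ∀ F₁ F₂ : Cfg → ℝ, Loc F₁ → Loc F₂ → ∀ n : ℕ, 2 * n < L → |Ex (fun U => F₁ U * F₂ (σ n U)) - Ex F₁ * Ex (fun U => F₂ (σ n U))| ≤ C * Real.exp (-(m * n))) → ∃ β₁ : ℝ, ∀ β : ℝ, β₁ ≤ β → ∃ m : ℝ, 0 < m ∧ (∀ (T' : ℕ) [NeZero T'], T ≤ T' → Cl (fun _ => T') (E β) β m) ∧ (∀ s : ℝ, 0 ≤ s → s ≤ E β → Cl (fun L => L) s β m)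

-- earlier ContinuumLegGivenGap (stmt-QuantumFields-8782, replaced 2026-08-16T17:42:01Z -> stmt-QuantumFields-15828): moot by None — ∀ (G : Type) [Group G] [TopologicalSpace G] [IsTopologicalGroup G] [CompactSpace G], Literature.MathematicalPhysics.QuantumFieldTheory.IsCompactSimpleLieGroup G → letI : MeasurableSpace G := borel G; haveI : BorelSpace G := ⟨rfl⟩; (∀ r : Literature.MathematicalPhysics.Q
/-- item stmt-QuantumFields-15828 · crux · rank 4 · open · by operator
why it might fail: Joint continuum limit of all gauge-invariant fields with E1 and non-Gaussian tr F² are open; pinned to β_k → ∞ it also needs ξ(β)=1/m(β) → ∞ as β → ∞ (no freezing) and 1/m(β_k) to be THE correlation length of every species, k-uniformly.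
sources: JaffeWitten2000, Balaban1989, arXiv:1803.01950, OsterwalderSeiler1978, arXiv:2401.10507, Literature.Barriers.QuantumFields.UVStabilityNonUniqueness
[crux] (existence leg, RE-TYPED for the 2026-08-16 Statement) for every compact simple Lie group G:
IF for every faithful unitary r the volume-uniform weak-coupling lattice gap holds
(UniformLatticeGap body for G, Borel σ-algebra), THEN there are r, a sequential scheme sch WITH β_k
→ ∞ (`sch.HasWeakCouplingLimit`) and OS data T with IsYangMillsFor r sch T, T non-trivial and
non-Gaussian in tr F², and Δ > 0 with T.HasMassGap Δ ∧ HasLatticeMassGap r sch Δ. Intended use: a_k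
∝ m(β_k) with β_k → ∞ (ξ(β) → ∞ is 2001-refereed and hub-filed: DirichletWindow /
XiCompleteMonotonicity), joint continuum limit with E0–E4 at that scale (Bałaban UV control, E1 by
any of the hub's rotation routes), non-triviality from the curvature three/four-point function.
[deps: UniformLatticeGap] [difficulty: open-problem] -/
@[route_item "route-QuantumFields-SmallCircleAnchor", crux]
def ContinuumLegGivenGap : Prop :=
  ∀ (G : Type) [Group G] [TopologicalSpace G] [IsTopologicalGroup G] [CompactSpace G], Literature.MathematicalPhysics.QuantumFieldTheory.IsCompactSimpleLieGroup G → letI : MeasurableSpace G := borel G; haveI : BorelSpace G := ⟨rfl⟩; (∀ r : Literature.MathematicalPhysics.QuantumFieldTheory.LatticeRep G, ∃ β₀ : ℝ, ∀ β : ℝ, β₀ ≤ β → ∃ m : ℝ, 0 < m ∧ ∃ S₁ : ℕ, ∀ A B : Literature.MathematicalPhysics.QuantumFieldTheory.YMSpecies G, ∃ C : ℝ, ∀ S n : ℕ, S₁ ≤ S → n ≤ S → |Literature.MathematicalPhysics.QuantumFieldTheory.latticeConnectedCorr r.ρ β (2 * S + 1) A.F B.F n| ≤ C * Real.exp (-(m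 * n))) → ∃ (r : Literature.MathematicalPhysics.QuantumFieldTheory.LatticeRep G) (sch : Literature.MathematicalPhysics.QuantumFieldTheory.SpeciesScheme (Literature.MathematicalPhysics.QuantumFieldTheory.YMSpecies G)) (T : Literature.MathematicalPhysics.QuantumFieldTheory.OSData (Literature.MathematicalPhysics.QuantumFieldTheory.YMSpecies G) 4), sch.HasWeakCouplingLimit ∧ Literature.MathematicalPhysics.QuantumFieldTheory.IsYangMillsFor r sch T ∧ T.IsNontrivial r.curvature ∧ T.IsNonGaussian r.curvature ∧ ∃ Δ > 0, T.HasMassGap Δ ∧ Literature.MathematicalPhysics.QuantumFieldTheory.HasLatticeMassGap r sch Δ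

-- earlier OneLayerAnchor (stmt-QuantumFields-9040, replaced 2026-08-15T16:49:42Z -> stmt-QuantumFields-11143): retired by None — ∀ (G : Type) [Group G] [TopologicalSpace G] [IsTopologicalGroup G] [CompactSpace G], Literature.MathematicalPhysics.QuantumFieldTheory.IsCompactSimpleLieGroup G → letI : MeasurableSpace G := borel G; haveI : BorelSpace G := ⟨rfl⟩; ∀ r : Literature.MathematicalPhysics.Quant
/-- item stmt-QuantumFields-11143 · support · rank 9 · open · by planner
sources: Polyakov1977, BorgsSeiler1983, doi:10.1007/bf01961240, arXiv:0803.0344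
[support] (SPECIAL CASE T = 1 of AnchorGap = Polyakov 1977 on the lattice; implied by AnchorGap by
instantiation; inline vocabulary as in AnchorGap) with one time layer the Polyakov line is the
single time-like link u_x and the electric plaquettes are β Re tr r(u_x v_{x,i} u_{x+i}⁻¹
v_{x,i}⁻¹): Borgs–Seiler's one-layer model, i.e. three-dimensional lattice G-gauge theory with a
G-valued adjoint Higgs, which E(β)V(u_x) pins to the regular class Cl(g₀) — the lattice
Georgi–Glashow model in its abelianising (London) regime. Claim: uniform-in-volume exponential
clustering for all β ≥ β₀. The cleanest sub-target ('make Polyakov's monopole confinement of the 3D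
Georgi–Glashow model rigorous') and the first milestone for AnchorGap. [difficulty: XL] -/
@[route_item "route-QuantumFields-SmallCircleAnchor"]
def OneLayerAnchor : Prop :=
  ∀ (G : Type) [Group G] [TopologicalSpace G] [IsTopologicalGroup G] [CompactSpace G], Literature.MathematicalPhysics.QuantumFieldTheory.IsCompactSimpleLieGroup G → letI : MeasurableSpace G := borel G; haveI : BorelSpace G := ⟨rfl⟩; ∀ r : Literature.MathematicalPhysics.QuantumFieldTheory.LatticeRep G, ∃ V : G → ℝ, (Continuous V ∧ (∀ a g : G, V (a * g * a⁻¹) = V g) ∧ ∃ g₀ : G, (∀ g : G, V g₀ ≤ V g) ∧ (∀ g : G, V g = V g₀ → ∃ a : G, g = a * g₀ * a⁻¹) ∧ (∀ a b : G, a * g₀ = g₀ * a → b * g₀ = g₀ * b → a * b = b * a)) ∧ ∀ ε₁ : ℝ, ∃ E : ℝ → ℝ, (∀ β : ℝ, ε₁ ≤ E β) ∧ ∃ β₀ : ℝ, ∀ β : ℝ, β₀ ≤ β → ∃ m : ℝ, 0 < m ∧ ∀ w : ℕ, ∃ C : ℝ, ∀ (L : ℕ) [NeZero L], let St := ZMod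 1 × (Fin 3 → ZMod L); let Cfg := St × Option (Fin 3) → G; let ν : MeasureTheory.Measure Cfg := MeasureTheory.Measure.pi fun _ => Literature.MathematicalPhysics.QuantumFieldTheory.haarProbability G; let sh : St → Option (Fin 3) → St := fun x μ => Option.elim μ (x.1 + 1, x.2) fun i => (x.1, x.2 + Pi.single i 1); let pl : Cfg → St → Option (Fin 3) → Option (Fin 3) → G := fun U x μ κ => U (x, μ) * U (sh x μ, κ) * (U (sh x κ, μ))⁻¹ * (U (x, κ))⁻¹; let act : Cfg → ℝ := fun U => β * ∑ x : St, ∑ i : Fin 3, (r.ρ (pl U x none (some i))).trace.re + β * ∑ x : St, ∑ q : {q : Fin 3 × Fin 3 // q.1 < q.2}, (r.ρ (pl U x (some q.1.1) (some q.1.2))).trace.re; let P : Cfg → (Fin 3 → ZMod L) → G := fun U x => (List.ofFn fun t : Fin 1 => U ((((t : ℕ) : ZMod 1), x), none)).prod; let wgt : Cfg → ℝ := fun U => Real.exp (act U - E β * ∑ x : Fin 3 → ZMod L, V (P U x)); let Ex : (Cfg → ℝ) → ℝ := fun F => (∫ U, F U * wgt U ∂ν) / (∫ U, wgt U ∂ν);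 let σ : ℕ → Cfg → Cfg := fun n U p => U ((p.1.1, p.1.2 + Pi.single 0 (n : ZMod L)), p.2); ∀ (c : Fin 3 → ZMod L), let Loc := fun F : Cfg → ℝ => Measurable F ∧ (∀ U, |F U| ≤ 1) ∧ ∀ U U', (∀ p, (∀ i : Fin 3, (p.1.2 i - c i).val ≤ w) → U p = U' p) → F U = F U'; ∀ F₁ F₂ : Cfg → ℝ, Loc F₁ → Loc F₂ → ∀ n : ℕ, 2 * n < L → |Ex (fun U => F₁ U * F₂ (σ n U)) - Ex F₁ * Ex (fun U => F₂ (σ n U))| ≤ C * Real.exp (-(m * n))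

-- earlier PolyakovAnchorClustering (stmt-QuantumFields-9041, replaced 2026-08-15T16:49:42Z -> stmt-QuantumFields-11144): retired by None — ∀ (G : Type) [Group G] [TopologicalSpace G] [IsTopologicalGroup G] [CompactSpace G], Literature.MathematicalPhysics.QuantumFieldTheory.IsCompactSimpleLieGroup G → letI : MeasurableSpace G := borel G; haveI : BorelSpace G := ⟨rfl⟩; ∀ r : Literature.MathematicalPhy
/-- item stmt-QuantumFields-11144 · support · rank 9 · open · by planner
sources: BorgsSeiler1983, arXiv:0803.0344
[support] (SPECIAL CASE of AnchorGap for the Polyakov-loop two-point function — the observable of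
the Borgs–Seiler barrier; refutation surface; inline vocabulary as in AnchorGap) same setting and
quantifier prefix as AnchorGap, conclusion only for the Polyakov-loop two-point function: the
CONNECTED correlation Re⟨χ(P_0)χ̄(P_{n e₁})⟩ − ⟨Re χ(P_0)⟩⟨Re χ(P_n)⟩ − ⟨Im χ(P_0)⟩⟨Im χ(P_n)⟩
(χ(P_x) = tr r.ρ of the ordered product of the T time-like links above x) is ≤ C e^{−m n} uniformly
in L. Contrast: WITHOUT deformation the Borgs–Seiler barrier (Thm III.7, catalogued under
Literature/Barriers/QuantumFields) gives Polyakov long-range order at every T for β ≥ β₀(T) (U(N),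
SU(N)); the pinning defeats their proof exactly at the sum rule ⟨|tr u|²⟩ ≥ 1 (III.18), not at the
infrared bound, and under non-centre-symmetric pinning ⟨tr P⟩ ≠ 0 is expected but is not long-range
order of the connected function — a refuter who restores a sum rule forcing a δ(p)-mass in the
CONNECTED spectral measure kills AnchorGap. [difficulty: XL] -/
@[route_item "route-QuantumFields-SmallCircleAnchor"]
def PolyakovAnchorClustering : Prop :=
  ∀ (G : Type) [Group G] [TopologicalSpace G] [IsTopologicalGroup G] [CompactSpace G], Literature.MathematicalPhysics.QuantumFieldTheory.IsCompactSimpleLieGroup G → letI : MeasurableSpace G := borel G; haveI : BorelSpace G := ⟨rfl⟩; ∀ r : Literature.MathematicalPhysics.QuantumFieldTheory.LatticeRep G, ∃ V : G → ℝ, (Continuous V ∧ (∀ a g : G, V (a * g * a⁻¹) = V g) ∧ ∃ g₀ : G, (∀ g : G, V g₀ ≤ V g) ∧ (∀ g : G, V g = V g₀ → ∃ a : G, g = a * g₀ * a⁻¹) ∧ (∀ a b : G, a * g₀ = g₀ * a → b * g₀ = g₀ * b → a * b = b * a)) ∧ ∀ (T : ℕ) [NeZero T], ∀ ε₁ : ℝ,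 ∃ E : ℝ → ℝ, (∀ β : ℝ, ε₁ ≤ E β) ∧ ∃ β₀ : ℝ, ∀ β : ℝ, β₀ ≤ β → ∃ m : ℝ, 0 < m ∧ ∃ C : ℝ, ∀ (L : ℕ) [NeZero L], let St := ZMod T × (Fin 3 → ZMod L); let Cfg := St × Option (Fin 3) → G; let ν : MeasureTheory.Measure Cfg := MeasureTheory.Measure.pi fun _ => Literature.MathematicalPhysics.QuantumFieldTheory.haarProbability G; let sh : St → Option (Fin 3) → St := fun x μ => Option.elim μ (x.1 + 1, x.2) fun i => (x.1, x.2 + Pi.single i 1); let pl : Cfg → St → Option (Fin 3) → Option (Fin 3) → G := fun U x μ κ => U (x, μ) * U (sh x μ, κ) * (U (sh x κ, μ))⁻¹ * (U (x, κ))⁻¹; let act : Cfg → ℝ := fun U => β * ∑ x : St, ∑ i : Fin 3, (r.ρ (pl U x none (some i))).trace.re + β * ∑ x : St, ∑ q : {q : Fin 3 × Fin 3 // q.1 < q.2}, (r.ρ (pl U x (some q.1.1) (some q.1.2))).trace.re; let P : Cfg → (Fin 3 → ZMod L) → G := fun U x => (List.ofFn fun t : Fin T => U ((((t : ℕ) :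 ZMod T), x), none)).prod; let wgt : Cfg → ℝ := fun U => Real.exp (act U - E β * ∑ x : Fin 3 → ZMod L, V (P U x)); let Ex : (Cfg → ℝ) → ℝ := fun F => (∫ U, F U * wgt U ∂ν) / (∫ U, wgt U ∂ν); let χ := fun (U : Cfg) (x : Fin 3 → ZMod L) => (r.ρ (P U x)).trace; ∀ n : ℕ, 2 * n < L → let y : Fin 3 → ZMod L := Pi.single 0 (n : ZMod L); |Ex (fun U => (χ U 0 * (starRingEnd ℂ) (χ U y)).re) - (Ex (fun U => (χ U 0).re) * Ex (fun U => (χ U y).re) + Ex (fun U => (χ U 0).im) * Ex (fun U => (χ U y).im))| ≤ C * Real.exp (-(m * n))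

-- earlier EndpointTransfer (stmt-QuantumFields-9543, replaced 2026-08-15T16:49:42Z -> stmt-QuantumFields-11145): retired by None — ∀ (G : Type) [Group G] [TopologicalSpace G] [IsTopologicalGroup G] [CompactSpace G], Literature.MathematicalPhysics.QuantumFieldTheory.IsCompactSimpleLieGroup G → letI : MeasurableSpace G := borel G; haveI : BorelSpace G := ⟨rfl⟩; ∀ r : Literature.MathematicalPhysics.Qua
/-- item stmt-QuantumFields-11145 · support · rank 9 · closed · proved by Summit.QuantumFields.YangMills.Theorems.SmallCircleAnchor.endpointTransfer_proof @ 376347898b60 (prover) · by planner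
sources: OsterwalderSeiler1978, Seiler1982, Wilson1974
[support] (GLUE, provable now) the s = 0 endpoint of Leg B, in the finite-temperature presentation,
implies UniformLatticeGap for r: if for all β ≥ β₁ the undeformed Wilson theory on ℤ_L × (ℤ/L)³
(weight exp(β Σ_P Re tr r.ρ(U_P)) over all plaquettes, product Haar; inline vocabulary as in
AnchorGap without the deformation term) clusters in a spatial direction with rate m(β) uniformly in
L for bounded local observables, then latticeConnectedCorr r.ρ β (2S+1) A.F B.F n decays at rate
m(β) for all YMSpecies A, B, all S ≥ S₁ and all n ≤ S (S₁ = 0 works). Proof: identify the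
configurations (ℤ_L × (ℤ/L)³) × Option (Fin 3) → G with GaugeConfig 4 L G (time = coordinate 0,
`none` = time direction); exp(β Σ_P Re tr) = const·exp(−β·wilsonAction), so the normalised measure
is wilsonMeasure r.ρ β; coordinate-permutation invariance of the symmetric torus turns spatial into
temporal clustering; a cylinder observable (finite supp) composed with torusLift (2S+1) depends on
links in a cube of side w_A at some base point c; rescale by the bounds of A and B; n ≤ S ⇔ 2n <
2S+1. [difficulty: provable-now] -/
@[route_item "route-QuantumFields-SmallCircleAnchor", crux]
def EndpointTransfer : Prop :=
  ∀ (G : Type) [Group G] [TopologicalSpace G] [IsTopologicalGroup G] [CompactSpace G], Literature.MathematicalPhysics.QuantumFieldTheory.IsCompactSimpleLieGroup G → letI : MeasurableSpace G := borel G; haveI : BorelSpace G := ⟨rfl⟩; ∀ r : Literature.MathematicalPhysics.QuantumFieldTheory.LatticeRep G, (∃ β₁ : ℝ, ∀ β : ℝ, β₁ ≤ β → ∃ m : ℝ, 0 < m ∧ ∀ w : ℕ, ∃ C : ℝ, ∀ (L : ℕ) [NeZero L], let St := ZMod L × (Fin 3 → ZMod L); let Cfg := St × Option (Fin 3) → G;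 let ν : MeasureTheory.Measure Cfg := MeasureTheory.Measure.pi fun _ => Literature.MathematicalPhysics.QuantumFieldTheory.haarProbability G; let sh : St → Option (Fin 3) → St := fun x μ => Option.elim μ (x.1 + 1, x.2) fun i => (x.1, x.2 + Pi.single i 1); let pl : Cfg → St → Option (Fin 3) → Option (Fin 3) → G := fun U x μ κ => U (x, μ) * U (sh x μ, κ) * (U (sh x κ, μ))⁻¹ * (U (x, κ))⁻¹; let act : Cfg → ℝ := fun U => β * ∑ x : St, ∑ i : Fin 3, (r.ρ (pl U x none (some i))).trace.re + β * ∑ x : St, ∑ q : {q : Fin 3 × Fin 3 // q.1 < q.2}, (r.ρ (pl U x (some q.1.1) (some q.1.2))).trace.re; let wgt : Cfg → ℝ := fun U => Real.exp (act U); let Ex : (Cfg → ℝ) → ℝ := fun F => (∫ U, F U * wgt U ∂ν) / (∫ U, wgt U ∂ν); let σ : ℕ → Cfg → Cfg := fun n U p => U ((p.1.1, p.1.2 + Pi.single 0 (n : ZMod L)), p.2); ∀ (c : Fin 3 → ZMod L), let Loc := fun F : Cfg → ℝ => Measurable F ∧ (∀ U, |F U| ≤ 1) ∧ ∀ U U',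 (∀ p, (∀ i : Fin 3, (p.1.2 i - c i).val ≤ w) → U p = U' p) → F U = F U'; ∀ F₁ F₂ : Cfg → ℝ, Loc F₁ → Loc F₂ → ∀ n : ℕ, 2 * n < L → |Ex (fun U => F₁ U * F₂ (σ n U)) - Ex F₁ * Ex (fun U => F₂ (σ n U))| ≤ C * Real.exp (-(m * n))) → ∃ β₀ : ℝ, ∀ β : ℝ, β₀ ≤ β → ∃ m : ℝ, 0 < m ∧ ∃ S₁ : ℕ, ∀ A B : Literature.MathematicalPhysics.QuantumFieldTheory.YMSpecies G, ∃ C : ℝ, ∀ S n : ℕ, S₁ ≤ S → n ≤ S → |Literature.MathematicalPhysics.QuantumFieldTheory.latticeConnectedCorr r.ρ β (2 * S + 1) A.F B.F n| ≤ C * Real.exp (-(m * n))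

-- `EndpointTransfer` holds: proved by `Summit.QuantumFields.YangMills.Theorems.SmallCircleAnchor.endpointTransfer_proof` @ 376347898b60 (its module imports this route file, so no `_holds` link can be stated here).

-- earlier Assembly (stmt-QuantumFields-9042, replaced 2026-08-15T14:08:37Z -> stmt-QuantumFields-9658): retired by None — AnchorGap → AdiabaticContinuity → EndpointTransfer → ContinuumComplement → YangMills
/-- item stmt-QuantumFields-9658 · assembly · rank 1 · closed · proved by Summit.QuantumFields.YangMills.Theorems.smallCircleAnchor_assembly_proof (prover) · by planner
sources: JaffeWitten2000, arXiv:0803.0344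
[assembly] AnchorGap → AdiabaticContinuity → EndpointTransfer → ContinuumLegGivenGap → YangMills
(pure logic + one simp; the deciding theorem `closes` proves it). -/
@[route_item "route-QuantumFields-SmallCircleAnchor"]
def Assembly : Prop :=
  AnchorGap → AdiabaticContinuity → EndpointTransfer → ContinuumLegGivenGap → YangMills

-- `Assembly` holds: proved by `Summit.QuantumFields.YangMills.Theorems.smallCircleAnchor_assembly_proof` (its module imports this route file, so no `_holds` link can be stated here).

/-! D-0027 §2.1 — DECIDING THEOREM (planner-authored via `route open/edit --closes-file`; by planner-rrepair-QuantumFields-SmallCircleAncho-29b41918-0 2026-08-16T17:42:01Z):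
its hypotheses are this route's items and its conclusion the sub-problem Statement (glue_lint), and it elaborates with this file. -/

@[closes "route-QuantumFields-SmallCircleAnchor"] theorem closes : AnchorGap → AdiabaticContinuity → EndpointTransfer → ContinuumLegGivenGap → YangMills := by
  intro hA hT hE hC G i1 i2 i3 i4 hG
  refine hC G hG fun r => ?_
  letI : MeasurableSpace G := borel G
  haveI : BorelSpace G := ⟨rfl⟩
  obtain ⟨V, hV, hanch⟩ := hA G hG r
  obtain ⟨ε₁, hε₁⟩ := hT G hG r V hV 1
  obtain ⟨E, hE1, β₀, hβ₀⟩ := hanch 1 (max ε₁ 0)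
  obtain ⟨β₁, hβ₁⟩ := hε₁ E (fun β => (le_max_left _ _).trans (hE1 β)) β₀ hβ₀
  have hsym : (∃ β₁ : ℝ, ∀ β : ℝ, β₁ ≤ β → ∃ m : ℝ, 0 < m ∧ ∀ w : ℕ, ∃ C : ℝ, ∀ (L : ℕ) [NeZero L], let St := ZMod L × (Fin 3 → ZMod L); let Cfg := St × Option (Fin 3) → G; let ν : MeasureTheory.Measure Cfg := MeasureTheory.Measure.pi fun _ => Literature.MathematicalPhysics.QuantumFieldTheory.haarProbability G; let sh : St → Option (Fin 3) → St := fun x μ => Option.elim μ (x.1 + 1, x.2) fun i => (x.1, x.2 + Pi.single i 1); let pl : Cfg → St → Option (Fin 3) → Option (Fin 3) → G := fun U x μ κ => U (x, μ) * U (sh x μ, κ) * (U (sh x κ, μ))⁻¹ * (U (x, κ))⁻¹; let act : Cfg → ℝ := fun U => β * ∑ x : St, ∑ i : Fin 3, (r.ρ (pl U x none (some i))).trace.re + β * ∑ x : St, ∑ q : {q : Fin 3 × Fin 3 // q.1 < q.2}, (r.ρ (pl U x (some q.1.1) (some q.1.2))).trace.re; let wgt : Cfg → ℝ := fun U => Real.exp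 (act U); let Ex : (Cfg → ℝ) → ℝ := fun F => (∫ U, F U * wgt U ∂ν) / (∫ U, wgt U ∂ν); let σ : ℕ → Cfg → Cfg := fun n U p => U ((p.1.1, p.1.2 + Pi.single 0 (n : ZMod L)), p.2); ∀ (c : Fin 3 → ZMod L), let Loc := fun F : Cfg → ℝ => Measurable F ∧ (∀ U, |F U| ≤ 1) ∧ ∀ U U', (∀ p, (∀ i : Fin 3, (p.1.2 i - c i).val ≤ w) → U p = U' p) → F U = F U'; ∀ F₁ F₂ : Cfg → ℝ, Loc F₁ → Loc F₂ → ∀ n : ℕ, 2 * n < L → |Ex (fun U => F₁ U * F₂ (σ n U)) - Ex F₁ * Ex (fun U => F₂ (σ n U))| ≤ C * Real.exp (-(m * n))) := by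
    refine ⟨β₁, fun β hβ => ?_⟩
    obtain ⟨m, hm, -, hB⟩ := hβ₁ β hβ
    have h0 := hB 0 le_rfl ((le_max_right _ _).trans (hE1 β))
    refine ⟨m, hm, fun w => ?_⟩
    obtain ⟨C, hC⟩ := h0 w
    refine ⟨C, fun L hL => ?_⟩
    simpa only [zero_mul, sub_zero] using @hC L hL hL
  exact hE G hG r hsym

end Summit.QuantumFields.YangMills.Theses.SmallCircleAnchor
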